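/-
Copyright (c) 2026. All rights reserved.
Released under Apache 2.0 license as described in the file LICENSE.
Authors: abc-iut cell, prover seat abc-iut-f-101 (F fact-proving wave), over the statements of abc-iut-L4-t3.
-/
import Mathlib.CategoryTheory.Types.Basic
import Literature.AnabelianGeometry.AbsoluteAnabelian.DiagramUniversalTelecores
import Literature.AnabelianGeometry.AbsoluteAnabelian.LogFrobeniusMonoCoresProofs
import Literature.AnabelianGeometry.AbsoluteAnabelian.LogFrobeniusMonoBaseFacts
import HarnessLib

/-!
# [AbsTopIII] Corollary 5.10 (iv)(b)(c) (`Cor510MonoTelecore`, FACT-LIST F-0139): the mono-analytic telecore `𝔗_{An⊢}` and its contact structure — KERNEL CALIBRATION (empty corner, a failing setting, the diagonal setting)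

S. Mochizuki, *Topics in absolute anabelian geometry III: global reconstruction algorithms*,
J. Math. Sci. Univ. Tokyo 22 (2015) 939–1156 [MochizukiAbsTopIII2015]; locators `p.N` = pages of the author's
manuscript (`paper:url-5493eb38cbb7`), read on the page: Def 3.5 (iii), (iv) pp. 75–76 (cores, telecores, contact
structures), Def 5.6 (iii)–(iv) pp. 135–136 (the 1-commutative mono-analyticization diagrams), Cor 5.10 preamble
p. 146 ("mono-analyticization homotopies"), (iv)(a)–(c) pp. 147–148, proof p. 149 l. 2–3 ("immediate from the
definitions").

PROOF-ONLY companion (theorems only; nothing restated) of abc-iut-L4-t3's `LogFrobeniusCorollaries.lean`, whose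
`LogFrobeniusSetting.Cor510MonoTelecore L` — EXISTENCE of a core structure of `D•⊢_{≤6}` on `D•⊢_{≤5} ∪ D•_{≤6}`
(core vertex `An⊢[𝒩⊢⊞]`), of a telecore over it with the printed edges `φ^{An⊢⊞}_{w,ν} : An⊢[𝒩⊢⊞] → 𝒩⊢⊞_w`
(`MonoTelecoreIdx`, `monoTelecoreFun`), and of a contact structure containing the printed pairs of Cor 5.10 (iv)(c)
in both orders — is the cell's frozen FACT-LIST row F-0139, PARAMETRISED by the interface `L` (trunk docstring:
"ASSUMPTIONS on `L` that the text asserts for the genuine theaters").  Three kernel facts CALIBRATE the typed row: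

* `not_cor510MonoTelecore_of_isEmpty` — the degenerate corner `V(F_mod) = ∅` refutes it for EVERY setting (the
  vertex `□` reaches no `An⊢`; as for Cor 5.5 (i)/(ii) and Cor 5.10 (iv)(a), abc-iut-L4-t15).
* `exists_not_cor510MonoTelecore_of_not_retract` / `exists_not_cor510MonoTelecore` — it FAILS at a setting over
  EVERY index set, nonempty ones included: the diagonal setting modified so that the two mono-analyticization functors
  `𝒩⊞_v → 𝒩⊢⊞_v`, `𝒩_v → 𝒩⊢_v` are a constant functor; a core of `(D•⊢_{≤5} ∪ D•_{≤6}) ∪ {An⊢}` would relate the two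
  length-3 paths `𝒩_v → ℰ• → ℰ⊢ → An⊢` and `𝒩_v → 𝒩⊢_v → ℰ⊢ → An⊢` by an isomorphism.  This isolates the Def 5.6 (iv)
  1-commutativity datum `𝒩_v → 𝒩⊢_v → ℰ⊢ ≅ 𝒩_v → ℰ• → ℰ⊢` (hypothesis `hN` of `cor510MonoCores_of`,
  `LogFrobeniusMonoCoresProofs.lean`) as interface-missing datum number one for this row: print has it, the field
  list of `LogFrobeniusSetting` does not.
* `exists_cor510MonoTelecore_of_category` — it HOLDS at the diagonal setting on any large category for every NONEMPTY
  index set: every structure functor is the identity, fully faithful at EVERY vertex, so abc-iut-L4-t5's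
  universal-family toolkit (`DiagramUniversalTelecores.univTelecore`, `isContactStructure_restrictBoundary`) with
  `W :=` all vertices yields core, telecore and a contact structure containing all co-verticial pairs.

Hence `cor510MonoTelecore_independent` (over every nonempty index set both a holding and a failing setting exist:
F-0139 is INDEPENDENT of the interface, admissible only as an assumption on `L`, R5) and
`not_forall_cor510MonoTelecore` (the closed universal statement is false).  A REDUCED form in the style of
`cor510MonoCores_of` (the row from the mono-analyticization homotopies `hN`, `hκ`, "`ψ^{An⊢⊞}_{w,ν}` lies over `ℰ⊢`",
and the printed isomorphisms `η⊢_{v,ν}` lying over the core) is NOT in this file: the contact pairs of (iv)(c) end at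
`𝒩⊢⊞_v`, whose structure functor is not fully faithful, so the universal-family method does not apply verbatim
(cf. the `NOT here` note of `LogFrobeniusTelecoreProofs.lean`).  All witnesses are DEGENERATE calibration devices
(no arithmetic content).  Refereed pre-IUT material; nothing here bears on [IUTchIII] Cor. 3.12; OUR kernel check of a
typed statement, no side taken.
-/

set_option autoImplicit false

universe u

open CategoryTheory Quiver

namespace Literature.AnabelianGeometry.AbsoluteAnabelian

namespace LogFrobeniusSetting

variable {Vmod : Type u} {isArc : Vmod → Bool}

/-! ## The degenerate corner `V(F_mod) = ∅` -/

section Empty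

variable (L : LogFrobeniusSetting Vmod isArc)

/-- **`V(F_mod) ≠ ∅` is necessary** for `Cor510MonoTelecore` as typed (whatever the homotopies): its core clause asks
every vertex of `D•⊢_{≤5} ∪ D•_{≤6}` to reach the core vertex `An⊢[𝒩⊢⊞]`, and with `Vmod` empty the vertex `□` has
no outgoing arrow (cf. `not_cor510MonoCores_of_isEmpty`). [cite: MochizukiAbsTopIII2015, Cor 5.10 (iv)(b) p.147] -/
theorem not_cor510MonoTelecore_of_isEmpty [IsEmpty Vmod] : ¬ L.Cor510MonoTelecore := by
  rintro ⟨H, hH, hcore, -⟩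
  obtain ⟨p⟩ := hcore.reaches_obs ⟨.core, monoBase_six_core⟩
  have h := eq_core_of_path_of_isEmpty (P := monoBase 6) monoBase_six_core (x := .anMono)
    (fun i => by cases i) p
  change ExtVertex.obs = ExtVertex.base _ at h
  cases h

end Empty

/-! ## A setting with nonempty index set at which the row FAILS: no mono-analyticization homotopy in row 4 -/

section Twist

variable {C : Type (u + 1)} [Category.{u} C]

/-- `Λ_ν ∘ 𝟭 = 𝟭` for `log = 𝟭` (Def 5.4 (vii): `Λ_ν ∈ {id, log}`). [cite: MochizukiAbsTopIII2015, Def 5.4 (vii) p. 128] -/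
private theorem frobeniusTwist_id_comp_id' (b : Bool) : frobeniusTwist (𝟭 C) b ⋙ 𝟭 C = 𝟭 C := by
  cases b <;> rfl

/-- An isomorphism between objects equal to `x₀` and `z` exhibits `x₀` as a retract of `z` (cast bookkeeping: the
path functors of Def 3.5 (i) are propositionally, not definitionally, the evident composites). [folklore] -/
private theorem exists_retract_of_iso {x₀ z a b : C} (ha : a = x₀) (hb : b = z) (φ : a ≅ b) :
    ∃ (f : x₀ ⟶ z) (g : z ⟶ x₀), f ≫ g = 𝟙 x₀ := by
  subst ha hb
  exact ⟨φ.hom, φ.inv, φ.hom_inv_id⟩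

end Twist

section Fails

variable (Vmod isArc)

/-- **`Cor510MonoTelecore` FAILS at a setting with any index set**, on any large category `C` with objects `x₀`, `z`
such that `x₀` is not a retract of `z`: the diagonal setting on `C` (all rows `C`, structure functors `𝟭 C`,
equivalences `refl`, 2-cells identities) EXCEPT that the two mono-analyticization functors `𝒩⊞_v → 𝒩⊢⊞_v`,
`𝒩_v → 𝒩⊢_v` are the CONSTANT functor at `z` (the interface's one mono-analyticization homotopy
`𝒩⊞_v → 𝒩⊢⊞_v → 𝒩⊢_v ≅ 𝒩⊞_v → 𝒩_v → 𝒩⊢_v` still holds, as an identity).  A core structure of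
`(D•⊢_{≤5} ∪ D•_{≤6}) ∪ {An⊢[𝒩⊢⊞]}` would contain an INVERTIBLE homotopy between the functors of the two length-3
paths `𝒩_{v₀} → ℰ• → ℰ⊢ → An⊢` (`= 𝟭`) and `𝒩_{v₀} → 𝒩⊢_{v₀} → ℰ⊢ → An⊢` (`= const z`), i.e. `x₀ ≅ z`.  This is exactly
the Def 5.6 (iv) 1-commutativity datum `𝒩_v → 𝒩⊢_v → ℰ⊢ ≅ 𝒩_v → ℰ• → ℰ⊢` (hypothesis `hN` of abc-iut-L4-t15's
`cor510MonoCores_of`) that the interface `LogFrobeniusSetting` does not record.  DEGENERATE calibration witness.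
[cite: MochizukiAbsTopIII2015, Cor 5.10 (iv)(a) p.147] -/
theorem exists_not_cor510MonoTelecore_of_not_retract (C : Type (u + 1)) [Category.{u} C] (x₀ z : C)
    (hxz : ∀ (f : x₀ ⟶ z) (g : z ⟶ x₀), f ≫ g ≠ 𝟙 x₀) (v₀ : Vmod) :
    ∃ L : LogFrobeniusSetting Vmod isArc, L.X = C ∧ ¬ L.Cor510MonoTelecore := by
  let L₀ : LogFrobeniusSetting Vmod isArc :=
    { X := C
      E := C
      proj := 𝟭 C
      log := 𝟭 C
      logIsoId := Iso.refl _
      logOver := Iso.refl _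
      Nplus := fun _ => C
      N := fun _ => C
      forget := fun _ => 𝟭 C
      toE := fun _ => 𝟭 C
      lam := fun _ _ => 𝟭 C
      lamOver := fun _ _ => Iso.refl _
      lam_spaceLink_eq_postLog := fun _ => rfl
      iota := fun _ ν₁ _ _ => eqToHom (frobeniusTwist_id_comp_id' (C := C) ν₁.isPostLog)
      An := C
      κAn := CategoryTheory.Equivalence.refl
      φAn := 𝟭 C
      φAn_isEquivalence := inferInstance
      ηAn := Iso.refl _
      κAn₂ := CategoryTheory.Equivalence.refl
      Emono := C
      monoAn := 𝟭 C
      NmonoPlus := fun _ => C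
      Nmono := fun _ => C
      forgetMono := fun _ => 𝟭 C
      toEmono := fun _ => 𝟭 C
      monoNplus := fun _ => (Functor.const C).obj z
      monoN := fun _ => (Functor.const C).obj z
      monoHomotopy := fun _ => Iso.refl _
      AnMono := C
      κAnMono := CategoryTheory.Equivalence.refl
      ψAnMono := fun _ _ => 𝟭 C }
  refine ⟨L₀, rfl, ?_⟩
  rintro ⟨H, hH, hc, -⟩
  -- the two length-3 paths `𝒩_{v₀} → ℰ• → ℰ⊢ → An⊢` and `𝒩_{v₀} → 𝒩⊢_{v₀} → ℰ⊢ → An⊢` of `(D•⊢_{≤5} ∪ D•_{≤6}) ∪ {An⊢}`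
  let X : ExtShape.{u} (DSub (monoBase (Vmod := Vmod) (isArc := isArc) 6)) := obsShape (monoBase 6) DVertex.anMono
  let a : X.Vertex := X.base ⟨.nv v₀, monoBase_six_nv v₀⟩
  let p : Path a X.obs :=
    ((Path.nil.cons (show a ⟶ X.base ⟨.e5, monoBase_six_e5⟩ from DEdge.toE v₀)).cons
      (show X.base ⟨.e5, monoBase_six_e5⟩ ⟶ X.base ⟨.emono5, monoBase_six_emono5⟩ from DEdge.monoE5)).cons
      (show X.base ⟨.emono5, monoBase_six_emono5⟩ ⟶ X.obs from DEdge.κAnMono)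
  let q : Path a X.obs :=
    ((Path.nil.cons (show a ⟶ X.base ⟨.nmono v₀, monoBase_six_nmono v₀⟩ from DEdge.monoN v₀)).cons
      (show X.base ⟨.nmono v₀, monoBase_six_nmono v₀⟩ ⟶ X.base ⟨.emono5, monoBase_six_emono5⟩ from
        DEdge.toEmono v₀)).cons
      (show X.base ⟨.emono5, monoBase_six_emono5⟩ ⟶ X.obs from DEdge.κAnMono)
  have hE : H.E p q := hc.boundary_all p q
  haveI hiso : IsIso (H.η hE) := DiagramOfCategories.HomotopyFamily.isIso_of_isSymmetric _ H hc.isSymmetric hE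
  -- their functors at `x₀`: `x₀` and `z`
  have hp : (((L₀.subdiagram (monoBase 6)).extend (L₀.obsExt (monoBase 6) .anMono)).pathFunctor p).obj x₀ = x₀ := by
    rw [DiagramOfCategories.pathFunctor_cons, DiagramOfCategories.pathFunctor_cons,
      DiagramOfCategories.pathFunctor_cons, DiagramOfCategories.pathFunctor_nil]
    rfl
  have hq : (((L₀.subdiagram (monoBase 6)).extend (L₀.obsExt (monoBase 6) .anMono)).pathFunctor q).obj x₀ = z := by
    rw [DiagramOfCategories.pathFunctor_cons, DiagramOfCategories.pathFunctor_cons,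
      DiagramOfCategories.pathFunctor_cons, DiagramOfCategories.pathFunctor_nil]
    rfl
  obtain ⟨f, g, hfg⟩ := exists_retract_of_iso hp hq ((asIso (H.η hE)).app x₀)
  exact hxz f g hfg

/-- **F-0139 FAILS at a setting over every NONEMPTY index set too** (not only in the corner `V(F_mod) = ∅`): the
setting of `exists_not_cor510MonoTelecore_of_not_retract` on the category of types, `x₀ := Bool`, `z := PUnit`.
[cite: MochizukiAbsTopIII2015, Cor 5.10 (iv)(a) p.147] -/
theorem exists_not_cor510MonoTelecore (v₀ : Vmod) :
    ∃ L : LogFrobeniusSetting Vmod isArc, ¬ L.Cor510MonoTelecore := by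
  have hxz : ∀ (f : ULift.{u} Bool ⟶ PUnit.{u + 1}) (g : PUnit.{u + 1} ⟶ ULift.{u} Bool), f ≫ g ≠ 𝟙 _ := by
    intro f g h
    have h1 := congrArg (fun k : ULift.{u} Bool ⟶ ULift.{u} Bool => k (ULift.up true)) h
    have h2 := congrArg (fun k : ULift.{u} Bool ⟶ ULift.{u} Bool => k (ULift.up false)) h
    simp only [types_comp_apply, types_id_apply] at h1 h2
    have hs : f (ULift.up true) = f (ULift.up false) := Subsingleton.elim _ _
    rw [hs] at h1
    exact absurd (h1.symm.trans h2) (by simp)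
  obtain ⟨L, -, hL⟩ := exists_not_cor510MonoTelecore_of_not_retract Vmod isArc (Type u) (ULift.{u} Bool)
    PUnit.{u + 1} hxz v₀
  exact ⟨L, hL⟩

end Fails

/-! ## The row HOLDS at the diagonal setting (nonempty index set) -/

section Holds

variable (Vmod isArc)

/-- **Cor 5.10 (iv)(b)(c) as typed (`Cor510MonoTelecore`, F-0139) HOLDS at the diagonal setting** on any large
category `C` (all rows `C`, structure functors `𝟭 C`, equivalences `refl`, 2-cells identities, `ι⊞` the identification
`Λ_ν ∘ 𝟭 = 𝟭` — abc-iut-w4-d095's `LogFrobeniusSetting.diagonal`, rebuilt inline here), for every NONEMPTY index set: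
over `C` every vertex of the telecore diagram `(D•⊢_{≤5} ∪ D•_{≤6}) ∪ {An⊢[𝒩⊢⊞]} ∪ {φ^{An⊢⊞}_{w,ν}}` carries the identity
structure functor — FULLY FAITHFUL everywhere — so abc-iut-L4-t5's universal-family toolkit
(`DiagramUniversalTelecores`: `univCoreObs_isCore`, `univTelecore`, `isContactStructure_restrictBoundary`) with
`W :=` ALL vertices yields the core (every vertex reaches `An⊢`: `reach_anMono`, abc-iut-L4-t15), the telecore with the
printed edges `φ^{An⊢⊞}_{w,ν}` (`MonoTelecoreIdx` / `monoTelecoreFun`), and a contact structure whose boundary set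
contains EVERY co-verticial pair — in particular both orders of the printed pair
(`□ → 𝒩⊞_v → 𝒩_v → ℰ• → ℰ⊢ → An⊢ → 𝒩⊢⊞_v`, `□ → 𝒩⊞_v → 𝒩⊢⊞_v`) of Cor 5.10 (iv)(c).  DEGENERATE calibration witness
(model-witness of the typed row; no arithmetic content). [cite: MochizukiAbsTopIII2015, Cor 5.10 (iv)(b)(c) pp.147–148] -/
theorem exists_cor510MonoTelecore_of_category (C : Type (u + 1)) [Category.{u} C] [Nonempty Vmod] :
    ∃ L : LogFrobeniusSetting Vmod isArc, L.X = C ∧ L.Cor510MonoTelecore := by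
  let L : LogFrobeniusSetting Vmod isArc :=
    { X := C
      E := C
      proj := 𝟭 C
      log := 𝟭 C
      logIsoId := Iso.refl _
      logOver := Iso.refl _
      Nplus := fun _ => C
      N := fun _ => C
      forget := fun _ => 𝟭 C
      toE := fun _ => 𝟭 C
      lam := fun _ _ => 𝟭 C
      lamOver := fun _ _ => Iso.refl _
      lam_spaceLink_eq_postLog := fun _ => rfl
      iota := fun _ ν₁ _ _ => eqToHom (frobeniusTwist_id_comp_id' (C := C) ν₁.isPostLog)
      An := C
      κAn := CategoryTheory.Equivalence.refl
      φAn := 𝟭 C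
      φAn_isEquivalence := inferInstance
      ηAn := Iso.refl _
      κAn₂ := CategoryTheory.Equivalence.refl
      Emono := C
      monoAn := 𝟭 C
      NmonoPlus := fun _ => C
      Nmono := fun _ => C
      forgetMono := fun _ => 𝟭 C
      toEmono := fun _ => 𝟭 C
      monoNplus := fun _ => 𝟭 C
      monoN := fun _ => 𝟭 C
      monoHomotopy := fun _ => Iso.refl _
      AnMono := C
      κAnMono := CategoryTheory.Equivalence.refl
      ψAnMono := fun _ _ => 𝟭 C }
  refine ⟨L, rfl, ?_⟩
  let X : ExtShape.{u} (DSub (monoBase (Vmod := Vmod) (isArc := isArc) 6)) := obsShape (monoBase 6) DVertex.anMono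
  have hreach : ∀ a : DSub (monoBase (Vmod := Vmod) (isArc := isArc) 6), Nonempty (Path (X.base a) X.obs) :=
    reach_anMono
  -- the (identity) structure functor of every vertex of `D•⊢` over `C`
  let N : (a : DVertex Vmod isArc) → (a.category L ⥤ C) := fun a =>
    match a with
    | .row1 _ => 𝟭 C | .core => 𝟭 C | .nplus _ => 𝟭 C | .nv _ => 𝟭 C | .e5 => 𝟭 C | .an => 𝟭 C | .e7 => 𝟭 C
    | .nmonoPlus _ => 𝟭 C | .nmono _ => 𝟭 C | .emono5 => 𝟭 C | .anMono => 𝟭 C | .emono7 => 𝟭 C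
  have hμ : ∀ {a b : DVertex Vmod isArc} (e : DEdge isArc a b), DEdge.functor L e ⋙ N b = N a := by
    intro a b e
    cases e <;> rfl
  let O : (L.subdiagram (monoBase 6)).OverData C :=
    { N := fun a => N a.1
      μ := fun e => eqToIso (hμ e) }
  let cI : ∀ (a : DSub (monoBase (Vmod := Vmod) (isArc := isArc) 6)) (i : X.I a),
      (L.obsExt (monoBase 6) .anMono).obsMap i ⋙ 𝟭 C ≅ O.N a :=
    fun a i => eqToIso (hμ (show DEdge isArc a.1 DVertex.anMono from i))
  let cJ : ∀ (a : DSub (monoBase (Vmod := Vmod) (isArc := isArc) 6)) (j : MonoTelecoreIdx a.1),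
      L.monoTelecoreFun a.1 j ⋙ O.N a ≅ 𝟭 C := fun a j => by
    obtain ⟨a, ha⟩ := a
    cases a with
    | nmonoPlus w => exact Iso.refl _
    | _ => exact PEmpty.elim j
  have hW : ∀ w : (⟨X.I, fun a => MonoTelecoreIdx a.1⟩ : ExtShape.{u} _).Vertex, True →
      ((DiagramOfCategories.teleOver X (L.obsExt (monoBase 6) .anMono) O (𝟭 C) cI (fun a => MonoTelecoreIdx a.1)
        (fun {a} j => L.monoTelecoreFun a.1 j) cJ).N w).FullyFaithful := by
    rintro (⟨a, ha⟩ | _) -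
    · change (N a).FullyFaithful
      cases a <;> exact Functor.FullyFaithful.id C
    · exact Functor.FullyFaithful.id C
  refine ⟨_, _,
    DiagramOfCategories.univCoreObs_isCore X (fun _ => (inferInstance : IsEmpty PEmpty.{u + 1}))
      (L.obsExt (monoBase 6) .anMono) O (𝟭 C) cI (Functor.FullyFaithful.id C) hreach,
    DiagramOfCategories.univTelecore X (fun _ => (inferInstance : IsEmpty PEmpty.{u + 1}))
      (L.obsExt (monoBase 6) .anMono) O (𝟭 C) cI (Functor.FullyFaithful.id C) (fun a => MonoTelecoreIdx a.1)
      (fun {a} j => L.monoTelecoreFun a.1 j) cJ (fun _ => True) hW trivial hreach,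
    rfl, HEq.rfl,
    ⟨_, DiagramOfCategories.isContactStructure_restrictBoundary X (fun _ => (inferInstance : IsEmpty PEmpty.{u + 1}))
      (L.obsExt (monoBase 6) .anMono) O (𝟭 C) cI (Functor.FullyFaithful.id C) (fun a => MonoTelecoreIdx a.1)
      (fun {a} j => L.monoTelecoreFun a.1 j) cJ (fun _ => True) hW trivial hreach
      (DiagramOfCategories.univE (fun _ => True)) (DiagramOfCategories.isSaturated_univE _) (fun _ _ _ _ h => h), ?_⟩⟩
  intro v ν hν hcore hnp hnv he5 hem hnm j
  exact ⟨⟨⟨_, trivial, _, _, Path.nil, rfl, rfl⟩⟩, ⟨⟨_, trivial, _, _, Path.nil, rfl, rfl⟩⟩⟩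

/-- **Over every nonempty index set there are settings at which the typed Cor 5.10 (iv)(b)(c) HOLDS and settings at
which it FAILS** — F-0139 is INDEPENDENT of the interface `LogFrobeniusSetting` (kernel, both directions; the
holding witness is the diagonal setting on the category of types): it is correctly carried as a named ASSUMPTION on
`L` (R5), and its failing witness isolates the Def 5.6 (iv) mono-analyticization homotopy as the first
interface-missing datum. [cite: MochizukiAbsTopIII2015, Cor 5.10 (iv)(b)(c) pp.147–148] -/
theorem cor510MonoTelecore_independent (v₀ : Vmod) :
    (∃ L : LogFrobeniusSetting Vmod isArc, L.Cor510MonoTelecore) ∧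
      ∃ L : LogFrobeniusSetting Vmod isArc, ¬ L.Cor510MonoTelecore := by
  haveI : Nonempty Vmod := ⟨v₀⟩
  obtain ⟨L, -, hL⟩ := exists_cor510MonoTelecore_of_category Vmod isArc (Type u)
  exact ⟨⟨L, hL⟩, exists_not_cor510MonoTelecore Vmod isArc v₀⟩

end Holds

/-- **F-0139 as a closed statement is false**: NOT every `LogFrobeniusSetting` carries the mono-analytic telecore
and contact structure of Cor 5.10 (iv)(b)(c) as typed (already over the one-point index set).
[cite: MochizukiAbsTopIII2015, Cor 5.10 (iv)(b) p.147] -/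
theorem not_forall_cor510MonoTelecore :
    ¬ ∀ (Vmod : Type u) (isArc : Vmod → Bool) (L : LogFrobeniusSetting Vmod isArc), L.Cor510MonoTelecore := by
  intro h
  obtain ⟨L, hL⟩ := exists_not_cor510MonoTelecore PUnit.{u + 1} (fun _ => false) PUnit.unit
  exact hL (h _ _ L)

end LogFrobeniusSetting

end Literature.AnabelianGeometry.AbsoluteAnabelian
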